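import Summits.Ventures.PercRepro.RankLevelSetPlaneSix
import Summits.Ventures.PercRepro.RankLevelSetDepCountSplit
import Summits.Ventures.PercRepro.RankLevelSetDepCount

/-!
# PercRepro — S1 BASICS: the objects and the small rank / closure facts of SUBCLAIM-S1 §4 (p4, gen 14)

`proofs/SUBCLAIM-S1-p2.md` §4 PROPOSITION A, typed per `proofs/S1-LEAN-SPEC-p2.md` L1 (this module carries the
definitions and the elementary lemmas; the counts are in `S1PlaneCounts` and `S1PairInjection`).

* `rank4Five M F` — the five-element subsets of `F` of rank `4`; `pairsOf M F` — the pairs `(C, B')` of a circuit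
  `C ⊆ F` and a set `B' ⊆ F ∖ C` with `|C| + |B'| = 5` and `cl(C ∪ B') = F` (night-1's pair objects);
* `closure_eq_closure_of_subset_of_eRk_le` — a finite `X ⊆ Y` with `r(Y) ≤ r(X)` has the closure of `Y`;
* `three_le_eRk_of_four_le_ncard` — under «lines have `≤ 3` points» a set with `≥ 4` points has rank `≥ 3`;
* `closure_eq_of_four_subset` — a four-subset of a rank-`≤ 3` set spans it; `plane_of_five_low` — a rank-`≤ 3`
  five-subset of a rank-`4` flat `F` lies in a plane `P ⊆ F` with `≤ 6` points;
* `mem_image_powersetCard_iff`, `card_image_powersetCard` — the `j`-subsets of a finite set as a finset of sets.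
Axioms: standard.
-/

open scoped Matroid

namespace PercRepro

namespace S1

open Set

variable {α : Type}

/-- The five-element subsets of `F` of rank `4`. -/
def rank4Five (M : Matroid α) (F : Set α) : Set (Set α) :=
  {Q : Set α | Q ⊆ F ∧ Q.ncard = 5 ∧ M.eRk Q = 4}

/-- The pairs `(C, B')`: a circuit `C ⊆ F`, a set `B' ⊆ F ∖ C`, `|C| + |B'| = 5`, `cl(C ∪ B') = F`. -/
def pairsOf (M : Matroid α) (F : Set α) : Set (Set α × Set α) :=
  {x : Set α × Set α | M.IsCircuit x.1 ∧ x.1 ⊆ F ∧ x.2 ⊆ F \ x.1 ∧ x.1.ncard + x.2.ncard = 5 ∧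
    M.closure (x.1 ∪ x.2) = F}

/-- A finite set `X ⊆ Y` whose rank is at least that of `Y` has the closure of `Y`. -/
theorem closure_eq_closure_of_subset_of_eRk_le (M : Matroid α) {X Y : Set α} (hX : X.Finite)
    (hXY : X ⊆ Y) (hr : M.eRk Y ≤ M.eRk X) : M.closure X = M.closure Y :=
  (M.isRkFinite_of_finite hX).closure_eq_closure_of_subset_of_eRk_ge_eRk hXY hr

/-- Under «lines have `≤ 3` points», a set `X ⊆ E` with at least `4` points has rank at least `3`. -/
theorem three_le_eRk_of_four_le_ncard (M : Matroid α)
    (hline : ∀ L ⊆ M.E, M.eRk L ≤ 2 → L.ncard ≤ 3) {X : Set α} (hX : X ⊆ M.E) (h4 : 4 ≤ X.ncard) :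
    (3 : ℕ∞) ≤ M.eRk X := by
  by_contra hlt
  push Not at hlt
  have h2 : M.eRk X < (2 : ℕ∞) + 1 := by
    rw [show ((2 : ℕ∞) + 1) = 3 by norm_num]; exact hlt
  have h2' : M.eRk X ≤ ((2 : ℕ) : ℕ∞) := by simpa using Order.le_of_lt_add_one h2
  have := hline X hX h2'
  omega

/-- A four-element subset `T` of a set `P ⊆ E` of rank `≤ 3` has rank exactly `3`, and `cl(T) = cl(P)`. -/
theorem closure_eq_of_four_subset (M : Matroid α) [M.Finite]
    (hline : ∀ L ⊆ M.E, M.eRk L ≤ 2 → L.ncard ≤ 3) {P T : Set α} (hP : P ⊆ M.E) (hrP : M.eRk P ≤ 3)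
    (hT : T ⊆ P) (hT4 : T.ncard = 4) : M.eRk T = 3 ∧ M.closure T = M.closure P := by
  have hTfin : T.Finite := M.ground_finite.subset (hT.trans hP)
  have h3 : (3 : ℕ∞) ≤ M.eRk T := three_le_eRk_of_four_le_ncard M hline (hT.trans hP) (by omega)
  have hle : M.eRk T ≤ 3 := (M.eRk_mono hT).trans hrP
  refine ⟨le_antisymm hle h3, ?_⟩
  exact closure_eq_closure_of_subset_of_eRk_le M hTfin hT (hrP.trans h3)

/-- A five-element subset `Q` of the rank-`4` flat `F` of rank `≤ 3` has rank exactly `3`; its closure is a plane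
`P ⊆ F` with at most `6` points containing `Q`. -/
theorem plane_of_five_low (M : Matroid α) [M.Finite]
    (hline : ∀ L ⊆ M.E, M.eRk L ≤ 2 → L.ncard ≤ 3) (hplane : ∀ P ⊆ M.E, M.eRk P ≤ 3 → P.ncard ≤ 6)
    {F Q : Set α} (hF : F ⊆ M.E) (hcl : M.closure F = F) (hQ : Q ⊆ F) (hQ5 : Q.ncard = 5)
    (hrQ : M.eRk Q ≤ 3) :
    M.eRk Q = 3 ∧ M.closure Q ⊆ F ∧ M.eRk (M.closure Q) = 3 ∧ (M.closure Q).ncard ≤ 6 ∧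
      Q ⊆ M.closure Q := by
  have hQE : Q ⊆ M.E := hQ.trans hF
  have h3 : (3 : ℕ∞) ≤ M.eRk Q := three_le_eRk_of_four_le_ncard M hline hQE (by omega)
  have hr : M.eRk Q = 3 := le_antisymm hrQ h3
  have hsub : M.closure Q ⊆ F := by
    rw [← hcl]; exact M.closure_subset_closure hQ
  have hrcl : M.eRk (M.closure Q) = 3 := by rw [M.eRk_closure_eq]; exact hr
  refine ⟨hr, hsub, hrcl, hplane _ (hsub.trans hF) hrcl.le, M.subset_closure Q hQE⟩

end S1

end PercRepro
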